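import Literature.Computability.Complexity.LazySampling
import Mathlib.Data.Fintype.Pi
import Literature.Computability.Complexity.BlockTuples
import HarnessLib

/-!
# Lazy sampling of a random oracle, II: the counting identity

Continuation of `LazySampling.lean` (Bennett–Gill's coin-flip simulation of an oracle machine run
against a random oracle, in G01's transcript model). Two finite probability spaces:

* the **oracle world**: tables `B : V → Bool` of oracle bits on a finite set `V` of strings
  (extended by `false`, `extB`), restricted to those agreeing with a hard-wired table `τ` on
  `F ⊆ V` (`tables V F τ`, the finite shadow of the cylinder of `τ`); the transcript `trB` of `M`
  on `x` against `B`;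
* the **coin world**: coin strings `f : Fin k → Bool`; the transcript `trY` of the lazy-sampling
  simulation `coinAns M F τ x (List.ofFn f)`.

**Main result** `lazySampling_count`: if `V ⊇ F` contains every query `M` can ask on `x` within
`k` rounds (against single-bit answers), then for every `j ≤ k` and every transcript `as`,
`2^k · #{B ∈ tables | trB B j = as} = #tables · #{f | trY f j = as}` — the distribution of the
transcript is the same in both worlds. Proof by induction on `j`: a table query and a repeated
query are answered identically in both worlds (consistency of the cache along genuine
transcripts, `cachedAnswer_traceT_historyFree`), and a fresh query is a fair bit independent of
the past in both worlds (the involutions flipping the oracle bit at the fresh query, resp. the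
coin of the current round, preserve the earlier transcript by locality and flip the answer:
`two_mul_card_filter_eq`). Consequences: the same identity for any property of the transcript
(`lazySampling_count_pred`) and for the output within `k` rounds (`lazySampling_count_run`).
This is the finite combinatorial content of Book–Vollmer–Wagner's Prop. 1–2 / Thm. 3
(`BP²P ⊆ BPP`: "the tree of all computations of `M` on input `x` for the different oracles is
finite").

## References

* C. H. Bennett, J. Gill, SIAM J. Comput. 10 (1981) 96–113 [BennettGill1981].
* R. V. Book, H. Vollmer, K. W. Wagner, ICALP 1996, LNCS 1099 [BookVollmerWagner1996], §3
  Prop. 1–2 (p. 373–374), §4 Thm. 3 (p. 374).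
-/

namespace Literature.Computability.Complexity

open _root_.Computability

namespace OracleAlg

variable {β : Type} {M : OracleAlg β} {x : List Bool}

/-! ### The two worlds: a random oracle patched by a finite table, and coins -/

section Worlds

variable (M x) (k : ℕ) (V F : Finset (List Bool)) (τ : F → Bool)

/-- A finite table of oracle bits on `V`, extended by `false`. [folklore] -/
def extB (V : Finset (List Bool)) (B : V → Bool) : List Bool → Bool :=
  fun u => if h : u ∈ V then B ⟨u, h⟩ else false

/-- Inside `V` the extended table is the table. [folklore] -/
theorem extB_of_mem {V : Finset (List Bool)} (B : V → Bool) {u : List Bool} (h : u ∈ V) :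
    extB V B u = B ⟨u, h⟩ := by
  simp [extB, h]

/-- Outside `V` the extended table answers `false`. [folklore] -/
theorem extB_of_not_mem {V : Finset (List Bool)} (B : V → Bool) {u : List Bool} (h : u ∉ V) :
    extB V B u = false := by
  simp [extB, h]

/-- Oracle world: the transcript of `M` on `x` against the table `B`. [folklore] -/
def trB (B : V → Bool) (j : ℕ) : List (List Bool) :=
  traceT M x (fun _ u => extB V B u) j

/-- Coin world: the transcript of the lazy-sampling simulation with coins `f`. [folklore] -/
def trY (f : Fin k → Bool) (j : ℕ) : List (List Bool) :=
  traceT M x (coinAns M F τ x (List.ofFn f)) j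

/-- The tables on `V` agreeing with `τ` on `F` (the finite shadow of the cylinder of `τ`). [folklore] -/
def tables : Finset (V → Bool) :=
  Finset.univ.filter fun B => ∀ u : F, extB V B u = τ u

variable {k V F τ}

/-- Unfolding lemma for `tables`. [folklore] -/
theorem mem_tables_iff {B : V → Bool} : B ∈ tables V F τ ↔ ∀ u : F, extB V B u = τ u := by
  simp [tables]

/-- `τ` extended by `false` is a table agreeing with `τ`. [folklore] -/
theorem tables_nonempty (hFV : F ⊆ V) : (tables V F τ).Nonempty := by
  classical
  refine ⟨fun v => if h : (v : List Bool) ∈ F then τ ⟨v, h⟩ else false, mem_tables_iff.2 fun u => ?_⟩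
  rw [extB_of_mem _ (hFV u.2)]
  simp [u.2]

/-- There is at least one table agreeing with `τ`. [folklore] -/
theorem card_tables_ne_zero (hFV : F ⊆ V) : (tables V F τ).card ≠ 0 :=
  Finset.card_ne_zero.2 (tables_nonempty hFV)

/-- **The lazy-sampling identity, counting form.** For every `j ≤ k` and every transcript `as`,
the number of tables (agreeing with `τ`) whose transcript after `j` rounds is `as`, times `2^k`,
equals the number of tables times the number of coin strings whose simulated transcript after
`j` rounds is `as` — provided `V ⊇ F` contains every query `M` can ask on `x` within `k` rounds. [cite: BookVollmerWagner1996, §3 Prop. 1–2 (p. 373–374) and §4 Thm. 3 (p. 374)] -/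
theorem lazySampling_count (hFV : F ⊆ V)
    (hV : ∀ (as : List (List Bool)) (u : List Bool), as.length < k →
      (∀ a ∈ as, ∃ c : Bool, a = [c]) → M.step x as = Sum.inl u → u ∈ V) :
    ∀ j ≤ k, ∀ as : List (List Bool),
      2 ^ k * ((tables V F τ).filter fun B => trB M x V B j = as).card =
        (tables V F τ).card *
          ((Finset.univ : Finset (Fin k → Bool)).filter fun f => trY M x k F τ f j = as).card := by
  classical
  intro j
  induction j with
  | zero =>
    intro _ as
    by_cases has : as = []
    · subst has
      simp [trB, trY, Fintype.card_bool, Fintype.card_fin, mul_comm]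
    · have h1 : ((tables V F τ).filter fun B => trB M x V B 0 = as) = ∅ :=
        Finset.filter_eq_empty_iff.2 fun B _ => by simpa [trB] using Ne.symm has
      have h2 : ((Finset.univ : Finset (Fin k → Bool)).filter fun f => trY M x k F τ f 0 = as) = ∅ :=
        Finset.filter_eq_empty_iff.2 fun f _ => by simpa [trY] using Ne.symm has
      rw [h1, h2]; simp
  | succ j IH =>
    intro hjk as'
    have hj : j < k := hjk
    have IHj := IH hj.le
    -- the bit identity (H3)
    have hbit : ∀ (as : List (List Bool)) (u : List Bool), M.step x as = Sum.inl u → ∀ c : Bool,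
        2 ^ k * ((tables V F τ).filter fun B => trB M x V B j = as ∧ extB V B u = c).card =
          (tables V F τ).card * ((Finset.univ : Finset (Fin k → Bool)).filter
            fun f => trY M x k F τ f j = as ∧ coinAns M F τ x (List.ofFn f) as u = c).card := by
      intro as u hstep c
      by_cases hempty : ((tables V F τ).filter fun B => trB M x V B j = as) = ∅
      · have hY : ((Finset.univ : Finset (Fin k → Bool)).filter fun f => trY M x k F τ f j = as) = ∅ := by
          have := IHj as
          rw [hempty, Finset.card_empty, mul_zero] at this
          exact Finset.card_eq_zero.1 ((mul_eq_zero.1 this.symm).resolve_left (card_tables_ne_zero hFV))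
        have h1 : ((tables V F τ).filter fun B => trB M x V B j = as ∧ extB V B u = c) = ∅ :=
          Finset.filter_eq_empty_iff.2 fun B hB h => Finset.filter_eq_empty_iff.1 hempty hB h.1
        have h2 : ((Finset.univ : Finset (Fin k → Bool)).filter
            fun f => trY M x k F τ f j = as ∧ coinAns M F τ x (List.ofFn f) as u = c) = ∅ :=
          Finset.filter_eq_empty_iff.2 fun f hf h => Finset.filter_eq_empty_iff.1 hY hf h.1
        rw [h1, h2]; simp
      obtain ⟨B₀, hB₀⟩ := Finset.nonempty_iff_ne_empty.2 hempty
      rw [Finset.mem_filter] at hB₀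
      have hlen : as.length = j := by rw [← hB₀.2]; exact length_traceT_of_inl M x _ (hB₀.2 ▸ hstep)
      have huV : u ∈ V := hV as u (hlen ▸ hj) (hB₀.2 ▸ traceT_entries M x _ j) hstep
      by_cases huF : u ∈ F
      · -- answered by the table in both worlds
        have e1 : ((tables V F τ).filter fun B => trB M x V B j = as ∧ extB V B u = c) =
            (tables V F τ).filter fun B => trB M x V B j = as ∧ τ ⟨u, huF⟩ = c :=
          Finset.filter_congr fun B hB => by rw [(mem_tables_iff.1 hB) ⟨u, huF⟩]
        have e2 : ((Finset.univ : Finset (Fin k → Bool)).filter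
            fun f => trY M x k F τ f j = as ∧ coinAns M F τ x (List.ofFn f) as u = c) =
            Finset.univ.filter fun f => trY M x k F τ f j = as ∧ τ ⟨u, huF⟩ = c :=
          Finset.filter_congr fun f _ => by rw [coinAns_of_mem]
        rw [e1, e2]
        by_cases hc : τ ⟨u, huF⟩ = c
        · simp only [hc, and_true]; exact IHj as
        · simp [hc]
      cases hca : cachedAnswer M x as u with
      | some c' =>
        -- a repeated query: answered by the cache in both worlds
        have e1 : ((tables V F τ).filter fun B => trB M x V B j = as ∧ extB V B u = c) =
            (tables V F τ).filter fun B => trB M x V B j = as ∧ c' = c := by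
          refine Finset.filter_congr fun B _ => ?_
          constructor
          · rintro ⟨h1, h2⟩
            refine ⟨h1, ?_⟩
            rw [← h2]
            refine cachedAnswer_traceT_historyFree (M := M) (x := x) (extB V B) j ?_
            rw [← trB, h1]; exact hca
          · rintro ⟨h1, h2⟩
            refine ⟨h1, ?_⟩
            rw [← h2]
            refine (cachedAnswer_traceT_historyFree (M := M) (x := x) (extB V B) j ?_).symm
            rw [← trB, h1]; exact hca
        have e2 : ((Finset.univ : Finset (Fin k → Bool)).filter
            fun f => trY M x k F τ f j = as ∧ coinAns M F τ x (List.ofFn f) as u = c) =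
            Finset.univ.filter fun f => trY M x k F τ f j = as ∧ c' = c :=
          Finset.filter_congr fun f _ => by rw [coinAns_of_cached τ huF hca]
        rw [e1, e2]
        by_cases hc : c' = c
        · simp only [hc, and_true]; exact IHj as
        · simp [hc]
      | none =>
        -- a fresh query: a fair bit in both worlds
        have hfresh := cachedAnswer_eq_none_iff.1 hca
        -- oracle world halving
        set i₀ : V := ⟨u, huV⟩ with hi₀
        set φ : (V → Bool) → (V → Bool) := fun B => Function.update B i₀ (!B i₀) with hφ
        have hφΩ : ∀ B ∈ tables V F τ, φ B ∈ tables V F τ := by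
          intro B hB
          rw [mem_tables_iff] at hB ⊢
          intro v
          have hne : (⟨(v : List Bool), hFV v.2⟩ : V) ≠ i₀ := fun h => huF (by
            have := congrArg Subtype.val h; simp [hi₀] at this; rw [← this]; exact v.2)
          rw [← hB v, extB_of_mem _ (hFV v.2), extB_of_mem _ (hFV v.2), hφ]
          exact Function.update_of_ne hne _ _
        have hφφ : ∀ B, φ (φ B) = B := by
          intro B; simp [hφ]
        have hP : ∀ B, trB M x V B j = as → trB M x V (φ B) j = as := by
          intro B hB
          rw [← hB]
          refine traceT_congr M x _ _ j fun i hi u' hu' => ?_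
          have hne : u' ≠ u := by
            rintro rfl
            rw [trB] at hB
            rw [hB] at hi hu'
            exact hfresh i hi hu'
          change extB V B u' = extB V (φ B) u'
          by_cases hu'V : u' ∈ V
          · rw [extB_of_mem _ hu'V, extB_of_mem _ hu'V, hφ]
            refine (Function.update_of_ne ?_ _ _).symm
            intro h; exact hne (congrArg Subtype.val h)
          · rw [extB_of_not_mem _ hu'V, extB_of_not_mem _ hu'V]
        have hg : ∀ B, extB V (φ B) u = !extB V B u := by
          intro B
          rw [extB_of_mem _ huV, extB_of_mem _ huV, hφ]
          simp [hi₀]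
        have hA := two_mul_card_filter_eq (tables V F τ) φ hφΩ hφφ
          (fun B => trB M x V B j = as) hP (fun B => extB V B u) hg c
        -- coin world halving
        set j₀ : Fin k := ⟨j, hj⟩ with hj₀
        set ψ : (Fin k → Bool) → (Fin k → Bool) := fun f => Function.update f j₀ (!f j₀) with hψ
        have hψψ : ∀ f, ψ (ψ f) = f := by
          intro f; simp [hψ]
        have hP' : ∀ f : Fin k → Bool, trY M x k F τ f j = as → trY M x k F τ (ψ f) j = as := by
          intro f hf
          rw [← hf]
          refine traceT_coinAns_congr τ j fun i hi => ?_
          rw [getD_ofFn f false (hi.trans hj), getD_ofFn (ψ f) false (hi.trans hj), hψ]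
          refine (Function.update_of_ne ?_ _ _).symm
          intro h; rw [hj₀] at h; cases h; exact lt_irrefl _ hi
        have hg' : ∀ f : Fin k → Bool,
            coinAns M F τ x (List.ofFn (ψ f)) as u = !coinAns M F τ x (List.ofFn f) as u := by
          intro f
          rw [coinAns_of_fresh τ huF hca, coinAns_of_fresh τ huF hca, hlen, getD_ofFn f false hj,
            getD_ofFn (ψ f) false hj, hψ]
          simp [hj₀]
        have hY := two_mul_card_filter_eq (Finset.univ : Finset (Fin k → Bool)) ψ (fun _ _ => Finset.mem_univ _)
          hψψ (fun f => trY M x k F τ f j = as) hP' (fun f => coinAns M F τ x (List.ofFn f) as u) hg' c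
        have := IHj as
        refine Nat.eq_of_mul_eq_mul_left zero_lt_two ?_
        calc 2 * (2 ^ k * ((tables V F τ).filter fun B => trB M x V B j = as ∧ extB V B u = c).card)
            = 2 ^ k * (2 * ((tables V F τ).filter fun B => trB M x V B j = as ∧ extB V B u = c).card) := by ring
          _ = 2 ^ k * ((tables V F τ).filter fun B => trB M x V B j = as).card := by rw [hA]
          _ = (tables V F τ).card * ((Finset.univ : Finset (Fin k → Bool)).filter fun f => trY M x k F τ f j = as).card := this
          _ = (tables V F τ).card * (2 * ((Finset.univ : Finset (Fin k → Bool)).filter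
                fun f => trY M x k F τ f j = as ∧ coinAns M F τ x (List.ofFn f) as u = c).card) := by rw [hY]
          _ = 2 * ((tables V F τ).card * ((Finset.univ : Finset (Fin k → Bool)).filter
                fun f => trY M x k F τ f j = as ∧ coinAns M F τ x (List.ofFn f) as u = c).card) := by ring
    -- termwise identity (H2)
    have hterm : ∀ as : List (List Bool),
        2 ^ k * ((tables V F τ).filter fun B =>
            trB M x V B j = as ∧ nextT M x (fun _ u => extB V B u) as = as').card =
          (tables V F τ).card * ((Finset.univ : Finset (Fin k → Bool)).filter fun f =>
            trY M x k F τ f j = as ∧ nextT M x (coinAns M F τ x (List.ofFn f)) as = as').card := by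
      intro as
      cases hs : M.step x as with
      | inr b =>
        have e1 : ((tables V F τ).filter fun B =>
            trB M x V B j = as ∧ nextT M x (fun _ u => extB V B u) as = as') =
            (tables V F τ).filter fun B => trB M x V B j = as ∧ as = as' :=
          Finset.filter_congr fun B _ => by rw [nextT_of_inr M x _ hs]
        have e2 : ((Finset.univ : Finset (Fin k → Bool)).filter fun f =>
            trY M x k F τ f j = as ∧ nextT M x (coinAns M F τ x (List.ofFn f)) as = as') =
            Finset.univ.filter fun f => trY M x k F τ f j = as ∧ as = as' :=
          Finset.filter_congr fun f _ => by rw [nextT_of_inr M x _ hs]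
        rw [e1, e2]
        by_cases h : as = as'
        · simp only [h, and_true]; exact IHj as'
        · simp [h]
      | inl u =>
        have e1 : ((tables V F τ).filter fun B =>
            trB M x V B j = as ∧ nextT M x (fun _ u => extB V B u) as = as') =
            (tables V F τ).filter fun B => trB M x V B j = as ∧ as ++ [[extB V B u]] = as' :=
          Finset.filter_congr fun B _ => by rw [nextT_of_inl M x _ hs]
        have e2 : ((Finset.univ : Finset (Fin k → Bool)).filter fun f =>
            trY M x k F τ f j = as ∧ nextT M x (coinAns M F τ x (List.ofFn f)) as = as') =
            Finset.univ.filter fun f =>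
              trY M x k F τ f j = as ∧ as ++ [[coinAns M F τ x (List.ofFn f) as u]] = as' :=
          Finset.filter_congr fun f _ => by rw [nextT_of_inl M x _ hs]
        rw [e1, e2]
        by_cases hform : ∃ c : Bool, as' = as ++ [[c]]
        · obtain ⟨c, rfl⟩ := hform
          have e3 : ((tables V F τ).filter fun B =>
              trB M x V B j = as ∧ as ++ [[extB V B u]] = as ++ [[c]]) =
              (tables V F τ).filter fun B => trB M x V B j = as ∧ extB V B u = c :=
            Finset.filter_congr fun B _ => by simp
          have e4 : ((Finset.univ : Finset (Fin k → Bool)).filter fun f =>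
              trY M x k F τ f j = as ∧ as ++ [[coinAns M F τ x (List.ofFn f) as u]] = as ++ [[c]]) =
              Finset.univ.filter fun f => trY M x k F τ f j = as ∧ coinAns M F τ x (List.ofFn f) as u = c :=
            Finset.filter_congr fun f _ => by simp
          rw [e3, e4]
          exact hbit as u hs c
        · have e3 : ((tables V F τ).filter fun B =>
              trB M x V B j = as ∧ as ++ [[extB V B u]] = as') = ∅ :=
            Finset.filter_eq_empty_iff.2 fun B _ h => hform ⟨_, h.2.symm⟩
          have e4 : ((Finset.univ : Finset (Fin k → Bool)).filter fun f =>
              trY M x k F τ f j = as ∧ as ++ [[coinAns M F τ x (List.ofFn f) as u]] = as') = ∅ :=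
            Finset.filter_eq_empty_iff.2 fun f _ h => hform ⟨_, h.2.symm⟩
          rw [e3, e4]; simp
    -- fiberwise decomposition (H1) along the transcript after `j` rounds
    set I : Finset (List (List Bool)) := (tables V F τ).image (fun B => trB M x V B j) ∪
      Finset.univ.image (fun f : Fin k → Bool => trY M x k F τ f j) with hI
    have dA : ((tables V F τ).filter fun B => trB M x V B (j + 1) = as').card =
        ∑ as ∈ I, ((tables V F τ).filter fun B =>
          trB M x V B j = as ∧ nextT M x (fun _ u => extB V B u) as = as').card := by
      rw [Finset.card_eq_sum_card_fiberwise (f := fun B => trB M x V B j) (t := I) fun B hB =>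
        Finset.mem_union_left _ (Finset.mem_image_of_mem _ (Finset.mem_filter.1 hB).1)]
      refine Finset.sum_congr rfl fun as _ => ?_
      rw [Finset.filter_filter]
      congr 1
      refine Finset.filter_congr fun B _ => ?_
      constructor
      · rintro ⟨h1, h2⟩; exact ⟨h2, by rw [← h2]; exact h1⟩
      · rintro ⟨h1, h2⟩; exact ⟨by rw [← h1] at h2; exact h2, h1⟩
    have dY : ((Finset.univ : Finset (Fin k → Bool)).filter fun f => trY M x k F τ f (j + 1) = as').card =
        ∑ as ∈ I, ((Finset.univ : Finset (Fin k → Bool)).filter fun f =>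
          trY M x k F τ f j = as ∧ nextT M x (coinAns M F τ x (List.ofFn f)) as = as').card := by
      rw [Finset.card_eq_sum_card_fiberwise (f := fun f => trY M x k F τ f j) (t := I) fun f _ =>
        Finset.mem_union_right _ (Finset.mem_image_of_mem _ (Finset.mem_univ f))]
      refine Finset.sum_congr rfl fun as _ => ?_
      rw [Finset.filter_filter]
      congr 1
      refine Finset.filter_congr fun f _ => ?_
      constructor
      · rintro ⟨h1, h2⟩; exact ⟨h2, by rw [← h2]; exact h1⟩
      · rintro ⟨h1, h2⟩; exact ⟨by rw [← h1] at h2; exact h2, h1⟩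
    rw [dA, dY, Finset.mul_sum, Finset.mul_sum]
    exact Finset.sum_congr rfl fun as _ => hterm as

/-- The counting identity for any property of the transcript after `j ≤ k` rounds. [folklore] -/
theorem lazySampling_count_pred (hFV : F ⊆ V)
    (hV : ∀ (as : List (List Bool)) (u : List Bool), as.length < k →
      (∀ a ∈ as, ∃ c : Bool, a = [c]) → M.step x as = Sum.inl u → u ∈ V)
    {j : ℕ} (hj : j ≤ k) (P : List (List Bool) → Prop) [DecidablePred P] :
    2 ^ k * ((tables V F τ).filter fun B => P (trB M x V B j)).card =
      (tables V F τ).card *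
        ((Finset.univ : Finset (Fin k → Bool)).filter fun f => P (trY M x k F τ f j)).card := by
  classical
  set I : Finset (List (List Bool)) := (tables V F τ).image (fun B => trB M x V B j) ∪
    Finset.univ.image (fun f : Fin k → Bool => trY M x k F τ f j) with hI
  have dA : ((tables V F τ).filter fun B => P (trB M x V B j)).card =
      ∑ as ∈ I, if P as then ((tables V F τ).filter fun B => trB M x V B j = as).card else 0 := by
    rw [Finset.card_eq_sum_card_fiberwise (f := fun B => trB M x V B j) (t := I) fun B hB =>
      Finset.mem_union_left _ (Finset.mem_image_of_mem _ (Finset.mem_filter.1 hB).1)]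
    refine Finset.sum_congr rfl fun as _ => ?_
    rw [Finset.filter_filter]
    split_ifs with h
    · congr 1
      exact Finset.filter_congr fun B _ => ⟨fun h' => h'.2, fun h' => ⟨h' ▸ h, h'⟩⟩
    · rw [Finset.card_eq_zero, Finset.filter_eq_empty_iff]
      rintro B - ⟨h1, h2⟩
      exact h (h2 ▸ h1)
  have dY : ((Finset.univ : Finset (Fin k → Bool)).filter fun f => P (trY M x k F τ f j)).card =
      ∑ as ∈ I, if P as then
        ((Finset.univ : Finset (Fin k → Bool)).filter fun f => trY M x k F τ f j = as).card else 0 := by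
    rw [Finset.card_eq_sum_card_fiberwise (f := fun f => trY M x k F τ f j) (t := I) fun f _ =>
      Finset.mem_union_right _ (Finset.mem_image_of_mem _ (Finset.mem_univ f))]
    refine Finset.sum_congr rfl fun as _ => ?_
    rw [Finset.filter_filter]
    split_ifs with h
    · congr 1
      exact Finset.filter_congr fun f _ => ⟨fun h' => h'.2, fun h' => ⟨h' ▸ h, h'⟩⟩
    · rw [Finset.card_eq_zero, Finset.filter_eq_empty_iff]
      rintro f - ⟨h1, h2⟩
      exact h (h2 ▸ h1)
  rw [dA, dY, Finset.mul_sum, Finset.mul_sum]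
  refine Finset.sum_congr rfl fun as _ => ?_
  split_ifs with h
  · exact lazySampling_count M x hFV hV j hj as
  · simp

/-- **The lazy-sampling identity for outputs**: the number of tables (agreeing with `τ`) against
which `M` outputs `b` within `k` rounds, times `2^k`, equals the number of tables times the number
of coin strings on which the lazy-sampling simulation outputs `b` within `k` rounds. [cite: BookVollmerWagner1996, §3 Prop. 1–2 (p. 373–374)] -/
theorem lazySampling_count_run [DecidableEq β] (hFV : F ⊆ V)
    (hV : ∀ (as : List (List Bool)) (u : List Bool), as.length < k →
      (∀ a ∈ as, ∃ c : Bool, a = [c]) → M.step x as = Sum.inl u → u ∈ V) (b : β) :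
    2 ^ k * ((tables V F τ).filter fun B => runWith M x (fun _ u => extB V B u) k [] = some b).card =
      (tables V F τ).card * ((Finset.univ : Finset (Fin k → Bool)).filter fun f =>
        runWith M x (coinAns M F τ x (List.ofFn f)) k [] = some b).card := by
  classical
  rcases Nat.eq_zero_or_pos k with rfl | hk
  · simp [runWith]
  have e1 : ((tables V F τ).filter fun B => runWith M x (fun _ u => extB V B u) k [] = some b) =
      (tables V F τ).filter fun B => M.step x (trB M x V B (k - 1)) = Sum.inr b :=
    Finset.filter_congr fun B _ => by rw [runWith_nil_eq_some_iff M x _ hk]; rfl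
  have e2 : ((Finset.univ : Finset (Fin k → Bool)).filter fun f =>
        runWith M x (coinAns M F τ x (List.ofFn f)) k [] = some b) =
      Finset.univ.filter fun f => M.step x (trY M x k F τ f (k - 1)) = Sum.inr b :=
    Finset.filter_congr fun f _ => by rw [runWith_nil_eq_some_iff M x _ hk]; rfl
  rw [e1, e2]
  exact lazySampling_count_pred M x hFV hV (Nat.sub_le k 1) fun as => M.step x as = Sum.inr b

end Worlds

end OracleAlg

end Literature.Computability.Complexity
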